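/-
Origin: expansion seat `prover-pub-hodgecm-mc-binder-1-g9-0`, handover #26a 2026-08-19T23:04Z md5 ba64d9d5a8a7 (NEW additive KERNEL leaf; E-currency NAME of the total W pin: `PlaneDefinite` + family `Gen12Pins.Wg` over unitary-1's `wmInputCM₂g` + read-backs `Wg_ρ_of`/`Wg_hSK`; installs after `Model/WmInputInstance` (#5 r3); drop ⇒ drop #26) (`HOME/mc/pub-hodgecm-mc-binder-1-g9/stage/HodgeCM/Model/Binders/WmInputGuarded.lean`, md5 ba64d9d5, 120 lines);
landed by the gen-13 packager (p-g13) in gate run 37 as `HodgeCM/Model/Binders/WmInputGuarded.lean` (verbatim).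
-/
/-
Origin: speedrun cell pub-hodgecm, MODEL-CONSTRUCTION sub-cell, unit pub-hodgecm-mc-binder-1-g9 (BINDER PROVER, gen 9; node B2-meet —
E-currency name of the TOTAL W pin of record), seat prover-pub-hodgecm-mc-binder-1-g9-0, 2026-08-19.
Target in PKG: HodgeCM/Model/Binders/WmInputGuarded.lean (NEW additive leaf, RUN 37; imports unitary-1's `Model/WmInputInstance` (RUN 37 row
#5 r3, md5 3c3dfacbac19 — THE W record of record, model1 (R1″)/(W-guard)); nothing landed imports it; consumed by `Binders/Gen12PinsTotal`).
KERNEL ONLY: one `abbrev … : Prop` naming the guard proposition (a decidable sign condition, NOT a hypothesis record), one `abbrev` family,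
`rfl` read-backs, two theorems re-exporting unitary-1's lemmas at the family; 0 records of published theorems, nothing cited, MODEL-N ±0, E unchanged.
History: binder-1's stand-in guarded record of 22:19Z (md5 2105fa760e7c, same decl names) LAPSED in favour of unitary-1's leaf (STATUS
2026-08-19T22:26:34Z / 22:44:40Z); this file is unitary-1's courtesy cut `work/winst/WmInputGuardedSlim.lean` c99696a9f8d8 (= binder-1's preamble +
`Gen12Pins` block VERBATIM over `import HodgeCM.Model.WmInputInstance`) with this header restored.
-/
import Summits.HodgeConjecture.HodgeCM.Model.WmInputInstance

/-!
# E currency for the TOTAL W pin: `PlaneDefinite` and the family `Gen12Pins.Wg`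

model1's (R1′) (2026-08-19T21:51:31Z): every pin input the END-STATE corollary keeps as a universally quantified family must be INHABITABLE at
every `(V, c)`; (R1″)/(W-guard) (22:14:14Z): the W record is guarded at FIELD level — unitary-1's `wmInputCM₂g V S hGR η hη hηc τ T hT`
(`Model/WmInputInstance`): `F := L⁺`, `ι := Fin 6`, `GU/ΓU/G/Γ/eV/eW/SK` unguarded (junction TYPES read them definitionally), and
`ρ := ρg … = if ⟨plane diag(a₀,a₁) definite at ι₁⟩ then (cmPairRepTwist … hGR η).toHomUnits else 1`, NO `hρ`/`hδ`/`h₁W` binders.  This leaf names: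

* `PlaneDefinite (S) : Prop` — the guard `(∀ j, 0 < (ι₁ (dW S j)).re) ∨ ∀ j, (ι₁ (dW S j)).re < 0` (read off any good context by sinst-1's
  `ArchSideTerm.dW_definite_of_thetaModel_goodCtx` / unitary-1's `WGuard.dW_definite_of_thetaModel_goodCtx`);
* the family **`Gen12Pins.Wg @hGR @η @hη @hηc @τ @T @hT : ∀ {L ι₁} V c, WmInput V c.D`** :=
  `fun V c => wmInputCM₂g V c.D (hGR V c) (η V c) (hη V c) (hηc V c) (τ V c) (T V c) (hT V c)` (7 inhabitable pin inputs: `hGR` = [GR91 Prop. 3.1.1]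
  (a `Prop` family), `η hη hηc` = twist-character data, `τ T hT` = the ball frame — of record `Gen12Pins.τSyl/TSyl/hTSyl`, kit #22), `Wg_apply` and the
  read-backs `Wg_F/_ι/_SK/_eV/_eW` (`rfl`), **`Wg_ρ_of (h : PlaneDefinite c.D)`** (the ONE rewrite opening every W-side junction proof under `GoodCtx`)
  and **`Wg_hSK (hV) (h)`** ((x-W) along `K_∞`, = unitary-1's `wmInputCM₂g_hSK`).
Nothing here is a claim of the manuscripts under adjudication.
-/

set_option autoImplicit false

noncomputable section

open MeasureTheory NumberField
open scoped Matrix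

namespace HodgeCM.Model

open HodgeCM HodgeCM.Adelic
open Literature.NumberTheory.Weil1964
open Literature.NumberTheory.Automorphic (piSchwartzBruhat)
open Literature.NumberTheory.GelbartRogawski1991.UnitaryDualPair
open Literature.RepresentationTheory.HeisenbergGroup


variable {L : CMField} {ι₁ : L →+* ℂ} (V : HermSpace3 L ι₁) (S : StubTree.SeesawDatum L)

local notation3 "L⁺" => maximalRealSubfield (L : Type)

/-- the guard: the plane `diag(a₀, a₁)` is DEFINITE at `ι₁` (period-1's `h₁W`, unitary-1's `wmInputCM₂s'` binder). -/
abbrev PlaneDefinite : Prop := (∀ j, 0 < (ι₁ (dW S j)).re) ∨ ∀ j, (ι₁ (dW S j)).re < 0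


/-! ## E currency: the TOTAL W family `Gen12Pins.Wg` -/

namespace Gen12Pins

variable
  (hGR : ∀ {L : CMField} {ι₁ : L →+* ℂ} (V : HermSpace3 L ι₁) (c : SeesawCtx L),
    (cmSplittingDatum (L : Type) finProdFinEquiv (frameD V) (frameD_real V) (frameD_ne V) (dW c.D) (dW_real c.D)
      (dW_ne c.D)).CompatibleSplitting)
  (η : ∀ {L : CMField} {ι₁ : L →+* ℂ} (V : HermSpace3 L ι₁) (c : SeesawCtx L),
    CMAdelic (L : Type) (frameD V) × CMAdelic (L : Type) (dW c.D) →* ℂˣ)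
  (hη : ∀ {L : CMField} {ι₁ : L →+* ℂ} (V : HermSpace3 L ι₁) (c : SeesawCtx L),
    ∀ γU ∈ CMRat (L : Type) (frameD V), ∀ γ ∈ CMRat (L : Type) (dW c.D), η V c (γU, γ) = 1)
  (hηc : ∀ {L : CMField} {ι₁ : L →+* ℂ} (V : HermSpace3 L ι₁) (c : SeesawCtx L), Continuous fun p => ((η V c p : ℂˣ) : ℂ))
  (τ : ∀ {L : CMField} {ι₁ : L →+* ℂ} (_V : HermSpace3 L ι₁) (_c : SeesawCtx L), L →+* ℂ)
  (T : ∀ {L : CMField} {ι₁ : L →+* ℂ} (_V : HermSpace3 L ι₁) (_c : SeesawCtx L), GL (Fin 3) ℂ)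
  (hT : ∀ {L : CMField} {ι₁ : L →+* ℂ} (V : HermSpace3 L ι₁) (c : SeesawCtx L),
    Literature.NumberTheory.Automorphic.formCongr (starRingEnd ℂ) (T V c) (V.Hm.map (τ V c)) =
      Literature.Geometry.ComplexHyperbolic.BallModel.J)

/-- **the TOTAL W family** `(V, c) ↦ wmInputCM₂g V c.D …` — E's binder type `∀ {L} {ι₁} (V) (c), WmInput V c.D`, every input inhabitable
((R1′)); apply with `@`-spelled family variables (#20 §2 note). -/
abbrev Wg : ∀ {L : CMField} {ι₁ : L →+* ℂ} (V : HermSpace3 L ι₁) (c : SeesawCtx L), WmInput V c.D :=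
  fun V c => wmInputCM₂g V c.D (hGR V c) (η V c) (hη V c) (hηc V c) (τ V c) (T V c) (hT V c)

variable {L : CMField} {ι₁ : L →+* ℂ} (V : HermSpace3 L ι₁) (c : SeesawCtx L)

/-- (Ported verbatim from the HodgeCMPerL package; no docstring in the source.) -/
theorem Wg_apply : Wg @hGR @η @hη @hηc @τ @T @hT V c =
    wmInputCM₂g V c.D (hGR V c) (η V c) (hη V c) (hηc V c) (τ V c) (T V c) (hT V c) := rfl

/-- (Ported verbatim from the HodgeCMPerL package; no docstring in the source.) -/
theorem Wg_F : (Wg @hGR @η @hη @hηc @τ @T @hT V c).F = ↥(maximalRealSubfield (L : Type)) := rfl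
/-- (Ported verbatim from the HodgeCMPerL package; no docstring in the source.) -/
theorem Wg_ι : (Wg @hGR @η @hη @hηc @τ @T @hT V c).ι = Fin 6 := rfl
/-- (Ported verbatim from the HodgeCMPerL package; no docstring in the source.) -/
theorem Wg_SK : (Wg @hGR @η @hη @hηc @τ @T @hT V c).SK =
    (cmKTypeTwist (L : Type) finProdFinEquiv (frameD V) (frameD_real V) (frameD_ne V) (dW c.D) (dW_real c.D) (dW_ne c.D) (hGR V c) (η V c)
        V.Hm (frameG V) (frame_congr V) (τ V c) (T V c) (hT V c)
        (Literature.NumberTheory.Automorphic.UnitaryGroup.archKappa (L : Type) V.Hm (τ V c) (T V c) (hT V c)) :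
      Set (CMSchwartz (L : Type) 6)) := rfl
/-- (Ported verbatim from the HodgeCMPerL package; no docstring in the source.) -/
theorem Wg_eV : (Wg @hGR @η @hη @hηc @τ @T @hT V c).eV =
    (cmFrameEquiv (L : Type) (frameG V) V.Hm (frameD V) (frame_congr V)).toMonoidHom := rfl
/-- (Ported verbatim from the HodgeCMPerL package; no docstring in the source.) -/
theorem Wg_eW : (Wg @hGR @η @hη @hηc @τ @T @hT V c).eW =
    (cmAdelicEquiv (L : Type) 2 (Matrix.diagonal (dW c.D))).toMonoidHom := rfl

/-- the ONE guarded read-back at the family: under plane-definiteness `(Wg … V c).ρ` is the `η`-normalised Weil action. -/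
theorem Wg_ρ_of (h : PlaneDefinite (ι₁ := ι₁) c.D) :
    (Wg @hGR @η @hη @hηc @τ @T @hT V c).ρ =
      (cmPairRepTwist (L : Type) finProdFinEquiv (frameD V) (frameD_real V) (frameD_ne V) (dW c.D) (dW_real c.D) (dW_ne c.D)
        (hGR V c) (η V c)).toHomUnits :=
  wmInputCM₂g_ρ_of V c.D (hGR V c) (η V c) (hη V c) (hηc V c) (τ V c) (T V c) (hT V c) h

/-- **(x-W) at the family, under the guard** (kit #12's `hSK` along `K_∞`). -/
theorem Wg_hSK (hV : IsAnisotropic L V.Hm) (h : PlaneDefinite (ι₁ := ι₁) c.D) :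
    ∀ Ψ : piSchwartzBruhat (Wg @hGR @η @hη @hηc @τ @T @hT V c).F (Wg @hGR @η @hη @hηc @τ @T @hT V c).ι,
      (∀ k : ↥(Literature.NumberTheory.Automorphic.UnitaryGroup.archIsotropy (L : Type) V.Hm (τ V c) (T V c) (hT V c)),
        (((Wg @hGR @η @hη @hηc @τ @T @hT V c).ρ
            ((Wg @hGR @η @hη @hηc @τ @T @hT V c).eV
              (archIsotropyRegime V hV (τ V c) (T V c) (hT V c) k : ↥(Adelic.adelicUnitaryGroup L V.Hm)), 1)) :
            Module.End ℂ (piSchwartzBruhat (Wg @hGR @η @hη @hηc @τ @T @hT V c).F (Wg @hGR @η @hη @hηc @τ @T @hT V c).ι)) Ψ =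
          ((Literature.NumberTheory.Automorphic.UnitaryGroup.archKappa (L : Type) V.Hm (τ V c) (T V c) (hT V c) k : ℂˣ) : ℂ) • Ψ) →
      Ψ ∈ (Wg @hGR @η @hη @hηc @τ @T @hT V c).SK :=
  wmInputCM₂g_hSK V c.D (hGR V c) (η V c) (hη V c) (hηc V c) (τ V c) (T V c) (hT V c) hV h

end Gen12Pins

end HodgeCM.Model

end
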